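import Summits.BirchSwinnertonDyer.BirchSwinnertonDyer.Theorems.KolyvaginRankRigidityAtTwoWalk
import HarnessLib

/-!
# Crux U1 `KolyvaginBoundedDefectAtTwo` (stmt-BirchSwinnertonDyer-28083), LINE 17 `regular_core_rigidity`,
# stub S1b `stub_nearCoreExistenceAtTwo` — THE WALK, part 3b: the induction on rounds and the near-core vertex

Width seat `bsd-line-krr2-p2` g15 (ONE READER on S1b); `--supports stmt-BirchSwinnertonDyer-28083` (helper).
THEOREMS ONLY; nothing here proves S1b, U1, a rung or BSD. BSD is NOT proved.

`walk_rounds`: for every number of rounds `t` and start exponents `(J, d)` there is an exponent `J'` — depending on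
`t, J, d` ONLY, not on the level `2^k` — such that from every vertex `H_{𝓕(c)}` with a frame whose alive set has `2t`
non-`x₀` classes (with `P` of sign `+1`, `N` of sign `−1`), the schedule of `…Walk` reaches, after adjoining EXACTLY
`max P N` regular Kolyvagin primes `> bnd` of index `≥ k+1`, a vertex `H_{𝓕(c')}` containing `x₀` with
`2^{J'} H_{𝓕(c')} ⊆ ℤ x₀ + ker res_{k+1}`. `nearCore_of_walk`: hence (Sah at `2`) `2^{J'+1} H_{𝓕(c')} ⊆ ℤ x₀` — a sign-free
NEAR-CORE vertex in the sense of S1b when `x₀` has order `2^k`. [cite: MazurRubin2004, §4.1, Prop. 4.1.5, Cor. 2.7.3]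
[cite: Jetchev2008, Prop. 5.3] [cite: GrossLMS1991, §9 Prop. 9.1]
Design: no definitions; `K : Type`; axioms `propext`, `Classical.choice`, `Quot.sound`.
-/

set_option autoImplicit false
-- the Theorems namespace of this sub repeats the summit name by design (D-0017 nested layout)
set_option linter.dupNamespace false

noncomputable section

open scoped Classical
open Function NumberField IsDedekindDomain WeierstrassCurve Field Finset
open Literature.NumberTheory.EllipticCurves Literature.NumberTheory.EllipticCurves.Jetchev2008
open Literature.NumberTheory.EllipticCurves.KolyvaginPairing
open Literature.NumberTheory.GaloisRepresentations Literature.NumberTheory.GaloisCohomology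
open Literature.NumberTheory.GaloisRepresentations.DiscreteGaloisModule (transverseSubgroup SelmerStructure)
open Literature.NumberTheory.Automorphic
open Summit.BirchSwinnertonDyer.Rank1Residual
open Summit.BirchSwinnertonDyer.Rank1Residual.JET.SelmerVocabulary
open Summit.BirchSwinnertonDyer.BirchSwinnertonDyer.Theorems.KolyvaginLowerBoundAtTwo (torsionFixing_le_of_dvd)

namespace Summit.BirchSwinnertonDyer.BirchSwinnertonDyer.Theorems.KolyvaginAtTwo.RegularWalk

variable {K : Type} [Field K] [NumberField K] (W : WeierstrassCurve ℚ) [W.IsElliptic] [W.IsGloballyMinimal]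

/-- **THE REGULAR-PRIME WALK (induction on rounds).** See the module docstring. The exponent `J'` is chosen BEFORE
the level `k` and all frame data (`∀ t J d, ∃ J', ∀ k …`), which is the uniformity in the level that S1b demands.
[cite: MazurRubin2004, §4.1, Prop. 4.1.5, Cor. 2.7.3] [cite: Jetchev2008, Prop. 5.3] -/
theorem walk_rounds (t : ℕ) : ∀ J d : ℕ, ∃ J' : ℕ, ∀ (k : ℕ) (_ : 1 ≤ k)
    (e : geomTorsion (W.baseChange K) ((2 ^ k : ℕ) : ℤ) → geomTorsion (W.baseChange K) ((2 ^ k : ℕ) : ℤ) →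
      AlgebraicClosure K)
    (_ : ∀ S T, e S T ^ (2 ^ k) = 1)
    (_ : ∀ S₁ S₂ T, e (S₁ + S₂) T = e S₁ T * e S₂ T)
    (_ : ∀ S T₁ T₂, e S (T₁ + T₂) = e S T₁ * e S T₂)
    (_ : ∀ (γ : absoluteGaloisGroup K) (S T : geomTorsion (W.baseChange K) ((2 ^ k : ℕ) : ℤ)),
      γ • e S T = e (γ • S) (γ • T))
    (_ : ∀ T, e T T = 1) (_ : ∀ T, (∀ S, e S T = 1) → T = 0)
    (inv : LocalInvariants K (2 ^ k)) (_ : inv.IsPerfect) (_ : inv.SumLocalTermEqZero) (_ : inv.SelmerComplement)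
    (_ : IsImaginaryQuadratic K) (_ : NumberField.discr K < -4) (_ : Odd (NumberField.discr K))
    (ι : K →+* ℂ) [∀ j : ℕ, NumberField (ringClassField K ι j)] [NeZero (W.conductorNorm ℤ)]
    (_ : SatisfiesHeegnerHypothesis (W.conductorNorm ℤ) K)
    (_ : W.HasSurjectiveModNGaloisRep 2) (_ : W.HasSurjectiveModNGaloisRep ((2 ^ (k + 1) : ℕ) : ℤ))
    (τ : K ≃ₐ[ℚ] K) (_ : τ ≠ 1)
    (_ : ∀ S T, liftAut τ (e S T) =
      e ((isLiftOfAut_liftAut τ).torsionMap W ((2 ^ k : ℕ) : ℤ) S) ((isLiftOfAut_liftAut τ).torsionMap W ((2 ^ k : ℕ) : ℤ) T))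
    (_ : inv.IsConjCompatible τ) (bnd : ℕ)
    (c : ℕ) (_ : Squarefree c)
    (_ : ∀ ℓ ∈ c.primeFactors, Zhang2014.IsKolyvaginPrime (W.conductorNorm ℤ) W K 2 ℓ ∧
      k + 1 ≤ Zhang2014.kolyvaginIndex W 2 ℓ ∧ bnd < ℓ ∧
      ∃ (v₁ : HeightOneSpectrum (𝓞 ℚ)) (𝔓₁ : Ideal (absIntegers (𝓞 ℚ) ℚ)) (h : absoluteGaloisGroup ℚ),
        (ℓ : 𝓞 ℚ) ∈ v₁.asIdeal ∧ 𝔓₁ ∈ v₁.primesAbove ∧ IsArithFrobAt (𝓞 ℚ) h 𝔓₁ ∧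
        (∀ X : geomTorsion W ((2 ^ k : ℕ) : ℤ), h • h • X = X) ∧
        ∃ P : geomTorsion W ((2 ^ k : ℕ) : ℤ), (2 : ℤ) ^ (k - 1) • (P + h • P) ≠ 0)
    (m : ℕ) (g : Fin m → galH1Torsion (W.baseChange K) ((2 ^ k : ℕ) : ℤ)) (sg : Fin m → ℤ) (A : Finset (Fin m))
    (i₀ : Fin m) (_ : i₀ ∈ A)
    (_ : ∀ i ∈ A, g i ∈ modifiedSelmerGroup W K ι ((2 ^ k : ℕ) : ℤ) c)
    (_ : ∀ i, sg i = 1 ∨ sg i = -1)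
    (_ : ∀ i, conjAct W τ ((2 ^ k : ℕ) : ℤ) (g i) = sg i • g i)
    (_ : (A.erase i₀).card = 2 * t)
    (_ : ∀ u : galH1Torsion (W.baseChange K) ((2 ^ k : ℕ) : ℤ), u ∈ modifiedSelmerGroup W K ι ((2 ^ k : ℕ) : ℤ) c →
      ∃ b : Fin m → ℤ, ∀ ρ ∈ torsionFixing (W.baseChange K) ((2 ^ (k + 1) : ℕ) : ℤ),
        h1Eval (W.baseChange K) ((2 ^ k : ℕ) : ℤ) (((2 : ℤ) ^ J) • u - ∑ i ∈ A, b i • g i) ρ = 0)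
    (_ : ∀ b : Fin m → ℤ, (∀ ρ ∈ torsionFixing (W.baseChange K) ((2 ^ (k + 1) : ℕ) : ℤ),
        h1Eval (W.baseChange K) ((2 ^ k : ℕ) : ℤ) (∑ i ∈ A, b i • g i) ρ = 0) → ∀ i ∈ A, (2 : ℤ) ^ (k - d) ∣ b i),
    ∃ c' : ℕ, Squarefree c' ∧
      c'.primeFactors.card = c.primeFactors.card +
        max ((A.erase i₀).filter (fun i ↦ sg i = 1)).card ((A.erase i₀).filter (fun i ↦ sg i = -1)).card ∧
      (∀ ℓ ∈ c'.primeFactors, Zhang2014.IsKolyvaginPrime (W.conductorNorm ℤ) W K 2 ℓ ∧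
        k + 1 ≤ Zhang2014.kolyvaginIndex W 2 ℓ ∧ bnd < ℓ ∧
        ∃ (v₁ : HeightOneSpectrum (𝓞 ℚ)) (𝔓₁ : Ideal (absIntegers (𝓞 ℚ) ℚ)) (h : absoluteGaloisGroup ℚ),
          (ℓ : 𝓞 ℚ) ∈ v₁.asIdeal ∧ 𝔓₁ ∈ v₁.primesAbove ∧ IsArithFrobAt (𝓞 ℚ) h 𝔓₁ ∧
          (∀ X : geomTorsion W ((2 ^ k : ℕ) : ℤ), h • h • X = X) ∧
          ∃ P : geomTorsion W ((2 ^ k : ℕ) : ℤ), (2 : ℤ) ^ (k - 1) • (P + h • P) ≠ 0) ∧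
      g i₀ ∈ modifiedSelmerGroup W K ι ((2 ^ k : ℕ) : ℤ) c' ∧
      ∀ u : galH1Torsion (W.baseChange K) ((2 ^ k : ℕ) : ℤ), u ∈ modifiedSelmerGroup W K ι ((2 ^ k : ℕ) : ℤ) c' →
        ∃ b : ℤ, ∀ ρ ∈ torsionFixing (W.baseChange K) ((2 ^ (k + 1) : ℕ) : ℤ),
          h1Eval (W.baseChange K) ((2 ^ k : ℕ) : ℤ) (((2 : ℤ) ^ J') • u - b • g i₀) ρ = 0 := by
  classical
  induction t with
  | zero =>
    intro J d
    refine ⟨J, ?_⟩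
    intro k hk e hμ hadd₁ hadd₂ hgal halt hnondeg inv hperf hvan hcomp hK hD hodd ι _ _ hH hρ2 hsurj τ hτ1 hτe hinvc bnd
      c hc hprimes m g sg A i₀ hi₀ hgS hsg hgτ ht hF3 hF4
    have hA0 : A.erase i₀ = ∅ := Finset.card_eq_zero.mp (by omega)
    have hA : A = {i₀} := by
      rcases (Finset.erase_eq_empty_iff A i₀).mp hA0 with h | h
      · exact absurd (h ▸ hi₀) (Finset.notMem_empty _)
      · exact h
    refine ⟨c, hc, by rw [hA0]; simp, hprimes, hgS i₀ hi₀, fun u hu ↦ ?_⟩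
    obtain ⟨b, hb⟩ := hF3 u hu
    refine ⟨b i₀, fun ρ hρ ↦ ?_⟩
    have h := hb ρ hρ
    rwa [hA, Finset.sum_singleton] at h
  | succ t ih =>
    intro J d
    obtain ⟨J', hJ'⟩ := ih (5 * J + 18 * d + 17) (8 * d + 2 * J + 7)
    refine ⟨J', ?_⟩
    intro k hk e hμ hadd₁ hadd₂ hgal halt hnondeg inv hperf hvan hcomp hK hD hodd ι _ _ hH hρ2 hsurj τ hτ1 hτe hinvc bnd
      c hc hprimes m g sg A i₀ hi₀ hgS hsg hgτ ht hF3 hF4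
    have hkol : ∀ ℓ ∈ c.primeFactors, Zhang2014.IsKolyvaginPrime (W.conductorNorm ℤ) W K 2 ℓ := fun ℓ h ↦ (hprimes ℓ h).1
    have hkM : ∀ ℓ ∈ c.primeFactors, k + 1 ≤ Zhang2014.kolyvaginIndex W 2 ℓ := fun ℓ h ↦ (hprimes ℓ h).2.1
    -- the sign census of the alive non-`x₀` classes
    have hneg : (A.erase i₀).filter (fun i ↦ ¬ sg i = 1) = ((A.erase i₀).filter (fun i ↦ sg i = -1)) := Finset.filter_congr fun i _ ↦
      ⟨fun h ↦ (hsg i).resolve_left h, fun h h' ↦ by rw [h'] at h; exact absurd h (by decide)⟩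
    have hPN : ((A.erase i₀).filter (fun i ↦ sg i = 1)).card + ((A.erase i₀).filter (fun i ↦ sg i = -1)).card = (A.erase i₀).card := by
      rw [← hneg]; exact Finset.card_filter_add_card_filter_not _
    -- the continuation: the induction hypothesis applied to the state after one round
    have cont : ∀ (c₁ : ℕ) (_ : Squarefree c₁) (n₁ : ℕ) (_ : c₁.primeFactors.card = c.primeFactors.card + n₁)
        (_ : ∀ ℓ ∈ c₁.primeFactors, Zhang2014.IsKolyvaginPrime (W.conductorNorm ℤ) W K 2 ℓ ∧
          k + 1 ≤ Zhang2014.kolyvaginIndex W 2 ℓ ∧ bnd < ℓ ∧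
          ∃ (v₁ : HeightOneSpectrum (𝓞 ℚ)) (𝔓₁ : Ideal (absIntegers (𝓞 ℚ) ℚ)) (h : absoluteGaloisGroup ℚ),
            (ℓ : 𝓞 ℚ) ∈ v₁.asIdeal ∧ 𝔓₁ ∈ v₁.primesAbove ∧ IsArithFrobAt (𝓞 ℚ) h 𝔓₁ ∧
            (∀ X : geomTorsion W ((2 ^ k : ℕ) : ℤ), h • h • X = X) ∧
            ∃ P : geomTorsion W ((2 ^ k : ℕ) : ℤ), (2 : ℤ) ^ (k - 1) • (P + h • P) ≠ 0)
        (A₁ : Finset (Fin m)) (_ : i₀ ∈ A₁) (_ : (A₁.erase i₀).card = 2 * t)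
        (_ : n₁ + max ((A₁.erase i₀).filter (fun i ↦ sg i = 1)).card ((A₁.erase i₀).filter (fun i ↦ sg i = -1)).card =
          max ((A.erase i₀).filter (fun i ↦ sg i = 1)).card ((A.erase i₀).filter (fun i ↦ sg i = -1)).card)
        (_ : ∀ i ∈ A₁, g i ∈ modifiedSelmerGroup W K ι ((2 ^ k : ℕ) : ℤ) c₁)
        (_ : ∀ u : galH1Torsion (W.baseChange K) ((2 ^ k : ℕ) : ℤ),
          u ∈ modifiedSelmerGroup W K ι ((2 ^ k : ℕ) : ℤ) c₁ →
          ∃ b : Fin m → ℤ, ∀ ρ ∈ torsionFixing (W.baseChange K) ((2 ^ (k + 1) : ℕ) : ℤ),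
            h1Eval (W.baseChange K) ((2 ^ k : ℕ) : ℤ) (((2 : ℤ) ^ (5 * J + 18 * d + 17)) • u - ∑ i ∈ A₁, b i • g i) ρ = 0)
        (_ : ∀ b : Fin m → ℤ, (∀ ρ ∈ torsionFixing (W.baseChange K) ((2 ^ (k + 1) : ℕ) : ℤ),
          h1Eval (W.baseChange K) ((2 ^ k : ℕ) : ℤ) (∑ i ∈ A₁, b i • g i) ρ = 0) →
          ∀ i ∈ A₁, (2 : ℤ) ^ (k - (8 * d + 2 * J + 7)) ∣ b i),
        ∃ c' : ℕ, Squarefree c' ∧ c'.primeFactors.card = c.primeFactors.card + max ((A.erase i₀).filter (fun i ↦ sg i = 1)).card ((A.erase i₀).filter (fun i ↦ sg i = -1)).card ∧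
          (∀ ℓ ∈ c'.primeFactors, Zhang2014.IsKolyvaginPrime (W.conductorNorm ℤ) W K 2 ℓ ∧
            k + 1 ≤ Zhang2014.kolyvaginIndex W 2 ℓ ∧ bnd < ℓ ∧
            ∃ (v₁ : HeightOneSpectrum (𝓞 ℚ)) (𝔓₁ : Ideal (absIntegers (𝓞 ℚ) ℚ)) (h : absoluteGaloisGroup ℚ),
              (ℓ : 𝓞 ℚ) ∈ v₁.asIdeal ∧ 𝔓₁ ∈ v₁.primesAbove ∧ IsArithFrobAt (𝓞 ℚ) h 𝔓₁ ∧
              (∀ X : geomTorsion W ((2 ^ k : ℕ) : ℤ), h • h • X = X) ∧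
              ∃ P : geomTorsion W ((2 ^ k : ℕ) : ℤ), (2 : ℤ) ^ (k - 1) • (P + h • P) ≠ 0) ∧
          g i₀ ∈ modifiedSelmerGroup W K ι ((2 ^ k : ℕ) : ℤ) c' ∧
          ∀ u : galH1Torsion (W.baseChange K) ((2 ^ k : ℕ) : ℤ), u ∈ modifiedSelmerGroup W K ι ((2 ^ k : ℕ) : ℤ) c' →
            ∃ b : ℤ, ∀ ρ ∈ torsionFixing (W.baseChange K) ((2 ^ (k + 1) : ℕ) : ℤ),
              h1Eval (W.baseChange K) ((2 ^ k : ℕ) : ℤ) (((2 : ℤ) ^ J') • u - b • g i₀) ρ = 0 := by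
      intro c₁ hc₁ n₁ hcard₁ hprimes₁ A₁ hi₀₁ ht₁ hcnt hgS₁ hF3₁ hF4₁
      obtain ⟨c', hc', hcard', hprimes', hx₀, hfin⟩ := hJ' k hk e hμ hadd₁ hadd₂ hgal halt hnondeg inv hperf hvan hcomp
        hK hD hodd ι hH hρ2 hsurj τ hτ1 hτe hinvc bnd c₁ hc₁ hprimes₁ m g sg A₁ i₀ hi₀₁ hgS₁ hsg hgτ ht₁ hF3₁ hF4₁
      exact ⟨c', hc', by rw [hcard', hcard₁, ← hcnt, add_assoc], hprimes', hx₀, hfin⟩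
    by_cases hboth : ((A.erase i₀).filter (fun i ↦ sg i = 1)).Nonempty ∧ ((A.erase i₀).filter (fun i ↦ sg i = -1)).Nonempty
    · -- ONE GOOD STEP
      obtain ⟨⟨i₁, hi₁P⟩, ⟨i₂, hi₂N⟩⟩ := hboth
      obtain ⟨hi₁B, hs₁⟩ := Finset.mem_filter.mp hi₁P
      obtain ⟨hi₂B, hs₂⟩ := Finset.mem_filter.mp hi₂N
      obtain ⟨hi₁0, hi₁A⟩ := Finset.mem_erase.mp hi₁B
      obtain ⟨hi₂0, hi₂A⟩ := Finset.mem_erase.mp hi₂B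
      have hne : i₁ ≠ i₂ := fun h ↦ by rw [h, hs₂] at hs₁; exact absurd hs₁ (by decide)
      obtain ⟨ℓ, hbndℓ, hℓc, hKol, hidx, hreg, hsurv, hF3', hF4'⟩ :=
        walkStep_good W k hk e hμ hadd₁ hadd₂ hgal halt hnondeg inv hperf hvan hK hD hodd ι hH hρ2 hsurj hτ1
          hc hkol hkM g sg A hgS hgτ hF3 hF4 hi₁A hi₂A hne hs₁ hs₂ bnd
      have hcℓ : Squarefree (c * ℓ) :=
        Nat.squarefree_mul_iff.mpr ⟨((Nat.Prime.coprime_iff_not_dvd hKol.1).mpr hℓc).symm, hc, hKol.1.squarefree⟩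
      have hpf : (c * ℓ).primeFactors = insert ℓ c.primeFactors := by
        rw [Nat.primeFactors_mul hc.ne_zero hKol.1.ne_zero, hKol.1.primeFactors, Finset.union_comm, ← Finset.insert_eq]
      have hcnt := card_filter_erase_erase A (fun i ↦ sg i = 1) hi₁0 hi₂0 hne hi₁A hi₂A
      have hcnt' := card_filter_erase_erase A (fun i ↦ sg i = -1) hi₁0 hi₂0 hne hi₁A hi₂A
      have hcntB := card_filter_erase_erase A (fun _ ↦ True) hi₁0 hi₂0 hne hi₁A hi₂A
      rw [Finset.filter_true, Finset.filter_true] at hcntB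
      simp only [if_true] at hcntB
      rw [hs₁, hs₂] at hcnt hcnt'
      simp only [if_true, show ¬ ((-1 : ℤ) = 1) by decide, show ¬ ((1 : ℤ) = -1) by decide, if_false, add_zero] at hcnt hcnt'
      refine cont (c * ℓ) hcℓ 1 (card_primeFactors_mul_of_not_dvd hc.ne_zero hKol.1 hℓc) ?_ ((A.erase i₁).erase i₂)
        (Finset.mem_erase.mpr ⟨hi₂0.symm |> fun h ↦ fun h' ↦ hi₂0 h'.symm, Finset.mem_erase.mpr
          ⟨fun h' ↦ hi₁0 h'.symm, hi₀⟩⟩) (by omega) ?_ hsurv (fun u hu ↦ frameF3_mono W k g _ (by omega) (hF3' u hu))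
        (frameF4_mono (le_refl d |> fun _ ↦ by omega) hF4')
      · intro ℓ' h
        rw [hpf, Finset.mem_insert] at h
        rcases h with rfl | h
        · exact ⟨hKol, hidx, hbndℓ, hreg⟩
        · exact hprimes ℓ' h
      · have hP1 : 1 ≤ ((A.erase i₀).filter (fun i ↦ sg i = 1)).card := Finset.card_pos.mpr ⟨i₁, hi₁P⟩
        have hN1 : 1 ≤ ((A.erase i₀).filter (fun i ↦ sg i = -1)).card := Finset.card_pos.mpr ⟨i₂, hi₂N⟩
        omega
    · -- A PURE STEP THEN A GOOD STEP: all alive non-`x₀` classes have one sign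
      have hB2 : (A.erase i₀).card = 2 * t + 2 := by omega
      obtain ⟨i₁, i₂, hi₁B, hi₂B, hne, hss, hcase⟩ : ∃ i₁ i₂ : Fin m, i₁ ∈ (A.erase i₀) ∧ i₂ ∈ (A.erase i₀) ∧ i₁ ≠ i₂ ∧ sg i₁ = sg i₂ ∧
          ((((A.erase i₀).filter (fun i ↦ sg i = 1)) = (A.erase i₀) ∧ ((A.erase i₀).filter (fun i ↦ sg i = -1)) = ∅) ∨ (((A.erase i₀).filter (fun i ↦ sg i = -1)) = (A.erase i₀) ∧ ((A.erase i₀).filter (fun i ↦ sg i = 1)) = ∅)) := by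
        rw [not_and_or, Finset.not_nonempty_iff_eq_empty, Finset.not_nonempty_iff_eq_empty] at hboth
        rcases hboth with hP0 | hN0
        · have hNB : ((A.erase i₀).filter (fun i ↦ sg i = -1)) = (A.erase i₀) := by
            apply Finset.eq_of_subset_of_card_le (Finset.filter_subset _ _)
            rw [hP0, Finset.card_empty, zero_add] at hPN; rw [hPN]
          have h2 : 1 < ((A.erase i₀).filter (fun i ↦ sg i = -1)).card := by rw [hNB, hB2]; omega
          obtain ⟨i₁, hi₁, i₂, hi₂, hne⟩ := Finset.one_lt_card.mp h2
          exact ⟨i₁, i₂, Finset.mem_of_mem_filter _ hi₁, Finset.mem_of_mem_filter _ hi₂, hne,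
            by rw [(Finset.mem_filter.mp hi₁).2, (Finset.mem_filter.mp hi₂).2], Or.inr ⟨hNB, hP0⟩⟩
        · have hPB : ((A.erase i₀).filter (fun i ↦ sg i = 1)) = (A.erase i₀) := by
            apply Finset.eq_of_subset_of_card_le (Finset.filter_subset _ _)
            rw [hN0, Finset.card_empty, add_zero] at hPN; rw [hPN]
          have h2 : 1 < ((A.erase i₀).filter (fun i ↦ sg i = 1)).card := by rw [hPB, hB2]; omega
          obtain ⟨i₁, hi₁, i₂, hi₂, hne⟩ := Finset.one_lt_card.mp h2
          exact ⟨i₁, i₂, Finset.mem_of_mem_filter _ hi₁, Finset.mem_of_mem_filter _ hi₂, hne,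
            by rw [(Finset.mem_filter.mp hi₁).2, (Finset.mem_filter.mp hi₂).2], Or.inl ⟨hPB, hN0⟩⟩
      obtain ⟨hi₁0, hi₁A⟩ := Finset.mem_erase.mp hi₁B
      obtain ⟨hi₂0, hi₂A⟩ := Finset.mem_erase.mp hi₂B
      obtain ⟨c', hc', hcard', hprimes', hsurv, hF3', hF4'⟩ :=
        round_pure_good W k hk e hμ hadd₁ hadd₂ hgal halt hnondeg inv hperf hvan hcomp hK hD hodd ι hH hρ2 hsurj hτ1 hτe
          hinvc bnd hc hprimes g sg A hgS hsg hgτ hF3 hF4 hi₁A hi₂A hne hss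
      have hcnt := card_filter_erase_erase A (fun i ↦ sg i = 1) hi₁0 hi₂0 hne hi₁A hi₂A
      have hcnt' := card_filter_erase_erase A (fun i ↦ sg i = -1) hi₁0 hi₂0 hne hi₁A hi₂A
      have hcntB := card_filter_erase_erase A (fun _ ↦ True) hi₁0 hi₂0 hne hi₁A hi₂A
      rw [Finset.filter_true, Finset.filter_true] at hcntB
      simp only [if_true] at hcntB
      refine cont c' hc' 2 hcard' hprimes' ((A.erase i₁).erase i₂)
        (Finset.mem_erase.mpr ⟨fun h' ↦ hi₂0 h'.symm, Finset.mem_erase.mpr ⟨fun h' ↦ hi₁0 h'.symm, hi₀⟩⟩) (by omega) ?_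
        hsurv hF3' hF4'
      rcases hcase with ⟨hPB, hN0⟩ | ⟨hNB, hP0⟩
      · have hs₁ : sg i₁ = 1 := (Finset.mem_filter.mp (by rw [hPB]; exact hi₁B : i₁ ∈ ((A.erase i₀).filter (fun i ↦ sg i = 1)))).2
        have hs₂ : sg i₂ = 1 := hss ▸ hs₁
        rw [hs₁, hs₂] at hcnt hcnt'
        simp only [if_true, show ¬ ((1 : ℤ) = -1) by decide, if_false, add_zero] at hcnt hcnt'
        rw [hN0, Finset.card_empty] at hcnt' ⊢
        rw [hPB, hB2] at hcnt ⊢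
        omega
      · have hs₁ : sg i₁ = -1 := (Finset.mem_filter.mp (by rw [hNB]; exact hi₁B : i₁ ∈ ((A.erase i₀).filter (fun i ↦ sg i = -1)))).2
        have hs₂ : sg i₂ = -1 := hss ▸ hs₁
        rw [hs₁, hs₂] at hcnt hcnt'
        simp only [if_true, show ¬ ((-1 : ℤ) = 1) by decide, if_false, add_zero] at hcnt hcnt'
        rw [hP0, Finset.card_empty] at hcnt ⊢
        rw [hNB, hB2] at hcnt' ⊢
        omega

end Summit.BirchSwinnertonDyer.BirchSwinnertonDyer.Theorems.KolyvaginAtTwo.RegularWalk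

end
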